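/-
Copyright (c) 2026 the pub-hodgecm-mathlib formalisation cell (harness21).  Prover seat hodgecm-mathlib-K2Liu-p10 (g3), Track B «K2-LIT»,
#184♮ = hLiu418 = `stmt-HodgeConjecture-24832`; Road Φ of socket #41, organ «Φ4-exact» (LEAD F0P6-plan (g13) RULINGS «M-157p» (3)–(4), 09:54:17Z,
09:57:20Z (Q3)): E4 = the SPLIT half of K2Liu-p12 (g2)'s method «E-det» — file 1, the residue-field core of the one value `I(1,1) = −q_v μ(B(0))`.
THEOREMS ONLY (no `def`, no `instance`, no named-fact hypothesis, no `sorry`).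
-/
import Mathlib.NumberTheory.LegendreSymbol.AddCharacter
import Mathlib.LinearAlgebra.Matrix.Determinant.Basic
import Mathlib.LinearAlgebra.Matrix.Trace
import Mathlib.LinearAlgebra.Matrix.NonsingularInverse
import HarnessLib

/-!
# Crux `HLiu418`, Road Φ, organ «Φ4-exact» (method «E-det»), E4 file 1: THE FOURIER TRANSFORM OF THE SINGULAR `2 × 2` MATRICES OVER A FINITE FIELD
# AT A NON-SINGULAR POINT — `Σ_{X ∈ M₂(k), det X = 0} ψ(tr(βX)) = −|k|` (`β ∈ GL₂(k)`, `ψ ≠ 1`)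

Cell `hodgecm-mathlib`, crux item hLiu418 = `stmt-HodgeConjecture-24832` (helper lane, count-neutral).  At a SPLIT good place `v` of the doubled hermitian
space (`U(2,2)(F_v) ≅ GL₄(F_v)`, `Herm₂(E_v) ≅ M₂(F_v)`), the one non-trivial lattice integral of K2Liu-p12 (g2)'s «E-det» reduction of the unramified
unimodular Whittaker value (census `K2/K2Liu-p12/g2/CENSUS-PHI4-EXACT-Method.K2Liu-p12-g2.md` §1 (c)–(d)) is
`I(1,1) = ∫_{B(−1) ∩ {|det t| ≤ q}} ψ_β dμ = μ(B(0)) · Σ_{X̄ ∈ M₂(k_v), det X̄ = 0} ψ₀(tr(β̄ X̄))`, `β̄ ∈ GL₂(k_v)`, `ψ₀ ≠ 1` the induced character of the residue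
field.  This file is the finite-field core, for ANY finite field `k` and any non-trivial additive character `ψ : k → ℂ` (automatically primitive,
Mathlib `AddChar.IsPrimitive.of_ne_one`):
* `sum_addChar_eq_neg_one` (`Σ_{a ≠ 0} ψ(a) = −1`), `sum_addChar_mul_left` (`Σ_x ψ(b·x) = |k|·𝟙[b = 0]`, ★ `AddChar.sum_mulShift`);
* `sum_row_singular_of_ne_zero` ∕ `sum_row_singular_zero` — for a fixed first row `(a, b)`: `Σ_{(c,d) : ad = bc} ψ(a + d) = ψ(a)·|k|·𝟙[b = 0]` if `(a,b) ≠ 0`,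
  `= 0` if `(a,b) = 0` (the second row runs over the line `k·(a,b)`; `Σ_λ ψ(λ b)` by orthogonality);
* **`sum_singular_addChar_trace`** — `Σ_{a,b,c,d ∈ k, ad − bc = 0} ψ(a + d) = −|k|`;
* **`sum_addChar_trace_of_det_eq_zero`** — matrix form `Σ_{X ∈ M₂(k), det X = 0} ψ(tr X) = −|k|`, and **`sum_addChar_trace_mul_of_det_eq_zero`** —
  `Σ_{det X = 0} ψ(tr(β X)) = −|k|` for `β` with `IsUnit β.det` (substitution `X ↦ βX`); `sum_addChar_trace_mul` — `Σ_{X ∈ M₂(k)} ψ(tr(βX)) = 0`.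
(The value `−|k|` is the rank stratification `1 + Σ_{rank 1} ψ(tr) = 1 − (|k| + 1)`: there are `|k|² − 1` rank-one matrices of trace `0` and `|k|(|k|+1)` of each
non-zero trace; together with `I(0,0) = μ(B(0))` it gives `W°∕μ(B(0)) = 1 − (q+1)t + q t² = (1 − t)(1 − q t)` at a split place, `ε_v = +1`.)
Sources: [KudlaRallis1994, §2]; [Shimura1997, §13 (local Siegel series at unimodular arguments)]; standard finite-field Fourier analysis.
HONEST LABEL.  Helper lemmas, count-neutral; `HC_CM` is proved only modulo the 7 printed citations (2 remaining named inputs: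
hLiu418 = `stmt-HodgeConjecture-24832`, h413 = `stmt-HodgeConjecture-24833`) until rung 0 closes.
-/

set_option autoImplicit false
set_option linter.dupNamespace false -- the mandated namespace repeats `HodgeConjecture.HodgeConjecture`

noncomputable section

open scoped BigOperators Matrix
open Finset

namespace Summit.HodgeConjecture.HodgeConjecture.Cruxes.HLiu418.K2LiuResidueSingularMatrixCharacterSum

variable {k : Type*} [Field k] [Fintype k] [DecidableEq k] {ψ : AddChar k ℂ}

/-! ## 1. Orthogonality on a finite field -/

/-- `Σ_x ψ(b·x) = |k|` if `b = 0` and `0` otherwise (`ψ ≠ 1` is primitive on a field). [folklore] -/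
theorem sum_addChar_mul_left (hψ : ψ ≠ 1) (b : k) : ∑ x : k, ψ (b * x) = if b = 0 then (Fintype.card k : ℂ) else 0 := by
  simp_rw [mul_comm b]
  rw [AddChar.sum_mulShift b (AddChar.IsPrimitive.of_ne_one hψ), Nat.cast_ite, Nat.cast_zero]

/-- `Σ_{a ≠ 0} ψ(a) = −1`. [folklore] -/
theorem sum_addChar_eq_neg_one (hψ : ψ ≠ 1) : ∑ a ∈ univ.erase (0 : k), ψ a = -1 := by
  have h := AddChar.sum_eq_zero_of_ne_one hψ
  rw [← Finset.sum_erase_add _ _ (Finset.mem_univ (0 : k)), AddChar.map_zero_eq_one] at h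
  linear_combination h

/-! ## 2. The second row runs over a line -/

/-- **first row `(a, b) ≠ 0`**: `Σ_{c,d : a d = b c} ψ(a + d) = ψ(a) · |k| · 𝟙[b = 0]`. [folklore] -/
theorem sum_row_singular_of_ne_zero (hψ : ψ ≠ 1) {a b : k} (hab : a ≠ 0 ∨ b ≠ 0) :
    ∑ c : k, ∑ d : k, (if a * d = b * c then ψ (a + d) else 0) = ψ a * (if b = 0 then (Fintype.card k : ℂ) else 0) := by
  by_cases ha : a = 0
  · -- `a = 0`, `b ≠ 0`: the condition is `c = 0`, the `d`-sum is `Σ_d ψ(d) = 0`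
    have hb : b ≠ 0 := hab.resolve_left (not_not.2 ha)
    subst ha
    simp only [zero_mul, zero_add, if_neg hb, mul_zero]
    have hinner : ∀ c : k, (∑ d : k, if (0 : k) = b * c then ψ d else 0) = if c = 0 then ∑ d : k, ψ d else 0 := by
      intro c
      by_cases hc : c = 0
      · simp [hc]
      · have hbc : (0 : k) ≠ b * c := fun h => hc (by rcases mul_eq_zero.1 h.symm with h | h; exact absurd h hb; exact h)
        simp [hbc, hc]
    simp_rw [hinner]
    rw [Finset.sum_ite_eq' Finset.univ (0 : k), if_pos (Finset.mem_univ _), AddChar.sum_eq_zero_of_ne_one hψ]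
  · -- `a ≠ 0`: for each `c` exactly one `d = b c ∕ a`
    have hinner : ∀ c : k, (∑ d : k, if a * d = b * c then ψ (a + d) else 0) = ψ (a + b * c / a) := by
      intro c
      rw [Finset.sum_eq_single_of_mem (b * c / a) (Finset.mem_univ _)]
      · rw [if_pos (by rw [← mul_div_assoc, mul_div_cancel_left₀ _ ha])]
      · intro d _ hd
        rw [if_neg]
        intro h
        exact hd (eq_div_of_mul_eq ha (by rw [mul_comm]; exact h))
    simp_rw [hinner, AddChar.map_add_eq_mul]
    rw [← Finset.mul_sum]
    congr 1
    simp_rw [show ∀ c : k, b * c / a = (b / a) * c from fun c => by rw [div_mul_eq_mul_div]]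
    rw [sum_addChar_mul_left hψ (b / a)]
    simp [div_eq_zero_iff, ha]

/-- **first row `0`**: `Σ_{c,d : 0·d = 0·c} ψ(0 + d) = |k| · Σ_d ψ(d) = 0`. [folklore] -/
theorem sum_row_singular_zero (hψ : ψ ≠ 1) :
    ∑ c : k, ∑ d : k, (if (0 : k) * d = 0 * c then ψ (0 + d) else 0) = 0 := by
  simp only [zero_mul, zero_add, if_true]
  rw [Finset.sum_const, AddChar.sum_eq_zero_of_ne_one hψ, smul_zero]

/-! ## 3. The Fourier transform of `{det = 0}` at the identity, and at any non-singular point -/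

/-- **`Σ_{a,b,c,d ∈ k, ad = bc} ψ(a + d) = −|k|`** (tuple form). [cite: KudlaRallis1994, §2] -/
theorem sum_singular_addChar_trace (hψ : ψ ≠ 1) :
    ∑ a : k, ∑ b : k, ∑ c : k, ∑ d : k, (if a * d = b * c then ψ (a + d) else 0) = -(Fintype.card k : ℂ) := by
  -- split off `a = 0` in the outer sum and `b = 0` in the next
  have hrow : ∀ a b : k, (∑ c : k, ∑ d : k, if a * d = b * c then ψ (a + d) else 0) =
      if a = 0 ∧ b = 0 then 0 else ψ a * (if b = 0 then (Fintype.card k : ℂ) else 0) := by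
    intro a b
    by_cases h : a = 0 ∧ b = 0
    · rw [if_pos h, h.1, h.2]; exact sum_row_singular_zero hψ
    · rw [if_neg h]; exact sum_row_singular_of_ne_zero hψ (not_and_or.1 h)
  simp_rw [hrow]
  -- the `b`-sum: only `b = 0` survives
  have hb : ∀ a : k, (∑ b : k, if a = 0 ∧ b = 0 then (0 : ℂ) else ψ a * (if b = 0 then (Fintype.card k : ℂ) else 0)) =
      if a = 0 then 0 else ψ a * (Fintype.card k : ℂ) := by
    intro a
    rw [← Finset.sum_erase_add _ _ (Finset.mem_univ (0 : k))]
    have hrest : ∑ b ∈ univ.erase (0 : k), (if a = 0 ∧ b = 0 then (0 : ℂ) else ψ a * (if b = 0 then (Fintype.card k : ℂ) else 0)) = 0 := by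
      refine Finset.sum_eq_zero fun b hb => ?_
      have hb0 : b ≠ 0 := Finset.ne_of_mem_erase hb
      simp [hb0]
    rw [hrest, zero_add]
    by_cases ha : a = 0 <;> simp [ha]
  simp_rw [hb]
  rw [← Finset.sum_erase_add _ _ (Finset.mem_univ (0 : k)), if_pos rfl, add_zero]
  have hrest : ∑ a ∈ univ.erase (0 : k), (if a = 0 then (0 : ℂ) else ψ a * (Fintype.card k : ℂ)) = ∑ a ∈ univ.erase (0 : k), ψ a * (Fintype.card k : ℂ) :=
    Finset.sum_congr rfl fun a ha => by rw [if_neg (Finset.ne_of_mem_erase ha)]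
  rw [hrest, ← Finset.sum_mul, sum_addChar_eq_neg_one hψ, neg_one_mul]

omit [Field k] [DecidableEq k] in
/-- the entries equivalence `k⁴ ≃ M₂(k)`, `(a,b,c,d) ↦ (a b; c d)`, transports the tuple sum to the matrix sum. [folklore] -/
theorem sum_matrix_eq_sum_tuple (f : Matrix (Fin 2) (Fin 2) k → ℂ) :
    ∑ X : Matrix (Fin 2) (Fin 2) k, f X = ∑ a : k, ∑ b : k, ∑ c : k, ∑ d : k, f !![a, b; c, d] := by
  have h : ∑ X : Matrix (Fin 2) (Fin 2) k, f X = ∑ p : k × k × k × k, f !![p.1, p.2.1; p.2.2.1, p.2.2.2] := by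
    refine Fintype.sum_equiv ⟨fun X => (X 0 0, X 0 1, X 1 0, X 1 1), fun p => !![p.1, p.2.1; p.2.2.1, p.2.2.2], fun X => ?_, fun p => ?_⟩
      _ _ fun X => ?_
    · exact Matrix.ext fun i j => by fin_cases i <;> fin_cases j <;> rfl
    · rfl
    · show f X = f !![X 0 0, X 0 1; X 1 0, X 1 1]
      congr 1
      exact Matrix.ext fun i j => by fin_cases i <;> fin_cases j <;> rfl
  rw [h]
  simp only [Fintype.sum_prod_type]

/-- **`Σ_{X ∈ M₂(k), det X = 0} ψ(tr X) = −|k|`.** [cite: KudlaRallis1994, §2] [cite: Shimura1997, §13] -/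
theorem sum_addChar_trace_of_det_eq_zero (hψ : ψ ≠ 1) :
    ∑ X : Matrix (Fin 2) (Fin 2) k, (if X.det = 0 then ψ X.trace else 0) = -(Fintype.card k : ℂ) := by
  rw [sum_matrix_eq_sum_tuple, ← sum_singular_addChar_trace hψ]
  refine Finset.sum_congr rfl fun a _ => Finset.sum_congr rfl fun b _ => Finset.sum_congr rfl fun c _ => Finset.sum_congr rfl fun d _ => ?_
  simp only [Matrix.det_fin_two_of, Matrix.trace_fin_two_of, sub_eq_zero]

/-- **THE FOURIER TRANSFORM OF THE SINGULAR MATRICES AT A NON-SINGULAR POINT**: `Σ_{X ∈ M₂(k), det X = 0} ψ(tr(βX)) = −|k|` for `β` invertible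
(substitute `X ↦ βX`, which preserves `{det = 0}`). [cite: KudlaRallis1994, §2] [cite: Shimura1997, §13] -/
theorem sum_addChar_trace_mul_of_det_eq_zero (hψ : ψ ≠ 1) {β : Matrix (Fin 2) (Fin 2) k} (hβ : IsUnit β.det) :
    ∑ X : Matrix (Fin 2) (Fin 2) k, (if X.det = 0 then ψ (β * X).trace else 0) = -(Fintype.card k : ℂ) := by
  rw [← sum_addChar_trace_of_det_eq_zero hψ]
  -- the bijection `X ↦ βX`
  refine Fintype.sum_equiv ⟨fun X => β * X, fun X => β⁻¹ * X, fun X => ?_, fun X => ?_⟩ _ _ fun X => ?_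
  · show β⁻¹ * (β * X) = X
    rw [← Matrix.mul_assoc, Matrix.nonsing_inv_mul _ hβ, Matrix.one_mul]
  · show β * (β⁻¹ * X) = X
    rw [← Matrix.mul_assoc, Matrix.mul_nonsing_inv _ hβ, Matrix.one_mul]
  · show (if X.det = 0 then ψ (β * X).trace else 0) = if (β * X).det = 0 then ψ (β * X).trace else 0
    simp only [Matrix.det_mul, mul_eq_zero, hβ.ne_zero, false_or]

omit [DecidableEq k] in
/-- `Σ_{X ∈ M₂(k)} ψ(tr(βX)) = 0` for `β` invertible (indeed for `β ≠ 0`): the Fourier transform of the whole lattice. [folklore] -/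
theorem sum_addChar_trace_mul (hψ : ψ ≠ 1) {β : Matrix (Fin 2) (Fin 2) k} (hβ : IsUnit β.det) :
    ∑ X : Matrix (Fin 2) (Fin 2) k, ψ (β * X).trace = 0 := by
  have h1 : ∑ X : Matrix (Fin 2) (Fin 2) k, ψ X.trace = 0 := by
    rw [sum_matrix_eq_sum_tuple]
    have h4 : ∀ a b c d : k, ψ (Matrix.trace !![a, b; c, d]) = ψ a * ψ d := fun a b c d => by
      rw [Matrix.trace_fin_two_of, AddChar.map_add_eq_mul]
    simp only [h4, ← Finset.mul_sum, AddChar.sum_eq_zero_of_ne_one hψ, mul_zero, Finset.sum_const_zero]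
  rw [← h1]
  refine Fintype.sum_equiv ⟨fun X => β * X, fun X => β⁻¹ * X, fun X => ?_, fun X => ?_⟩ _ _ fun X => rfl
  · show β⁻¹ * (β * X) = X
    rw [← Matrix.mul_assoc, Matrix.nonsing_inv_mul _ hβ, Matrix.one_mul]
  · show β * (β⁻¹ * X) = X
    rw [← Matrix.mul_assoc, Matrix.mul_nonsing_inv _ hβ, Matrix.one_mul]

/-- **the complementary count**: `Σ_{X ∈ M₂(k), det X ≠ 0} ψ(tr(βX)) = |k|` (difference of the two previous sums). [folklore] -/
theorem sum_addChar_trace_mul_of_det_ne_zero (hψ : ψ ≠ 1) {β : Matrix (Fin 2) (Fin 2) k} (hβ : IsUnit β.det) :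
    ∑ X : Matrix (Fin 2) (Fin 2) k, (if X.det = 0 then 0 else ψ (β * X).trace) = (Fintype.card k : ℂ) := by
  have h := sum_addChar_trace_mul hψ hβ
  have h0 := sum_addChar_trace_mul_of_det_eq_zero hψ hβ
  have hsplit : ∑ X : Matrix (Fin 2) (Fin 2) k, ψ (β * X).trace =
      ∑ X : Matrix (Fin 2) (Fin 2) k, (if X.det = 0 then ψ (β * X).trace else 0) +
        ∑ X : Matrix (Fin 2) (Fin 2) k, (if X.det = 0 then 0 else ψ (β * X).trace) := by
    rw [← Finset.sum_add_distrib]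
    refine Finset.sum_congr rfl fun X _ => ?_
    by_cases hX : X.det = 0 <;> simp [hX]
  rw [hsplit, h0] at h
  linear_combination h

end Summit.HodgeConjecture.HodgeConjecture.Cruxes.HLiu418.K2LiuResidueSingularMatrixCharacterSum

end
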